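import Literature.Geometry.Riemannian.SurgicalRicciFlow
import Literature.Geometry.Manifold.OpenEmbeddingCriterion
import Mathlib.Analysis.InnerProductSpace.Calculus
import HarnessLib

/-!
# Neck pieces from tube segments, ball pieces from ball embeddings

Topic `Geometry/Riemannian` (everything PROVED; no definitions, no named facts). The collared
pieces of a surgically modified Ricci flow (`Literature.Geometry.Riemannian.IsNeckPiece`,
`Literature.Geometry.Riemannian.IsBallPiece`, `SurgicalRicciFlow.lean`; B.-L. Chen, X.-P. Zhu,
J. Differential Geom. 74 (2006), Thm. 1.1 (iii) and §5, p. 29) ask for smooth embeddings of the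
whole cylinder `S³ × ℝ`, resp. of the whole `ℝ⁴`, whose middle third `S³ × (0, 1)`, resp. unit
ball, is the piece and whose rest lies in `N`. The tubes and balls produced by the metric-free
chaining of necks (`Literature.Geometry.Manifold.exists_tube_of_neckChain`, `NeckChain.lean`;
`Literature.Topology.FourManifolds.exists_ballEmbedding_of_cappedTube`, `CappedTube.lean`) come as
a tube `ι : S³ × ℝ ↪ M` with two prescribed slices, resp. a ball embedding `K : ℝ⁴ ↪ M` with a
prescribed sphere; this file performs the two reparametrisations:

* `isNeckPiece_image_Ioo` — for a smooth open embedding `ι : S³ × ℝ ↪ M⁴` and `t₁ < t₂` with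
  `ι(S³ × (ℝ ∖ (t₁, t₂))) ⊆ N`, the segment `ι(S³ × (t₁, t₂))` is a neck piece relative to `N`
  (affine reparametrisation of the height);
* `isBallPiece_image_ball` — for a smooth open embedding `K : ℝ⁴ ↪ M⁴`, `R > 0`, with
  `K({R/√2 ≤ ‖y‖ < R}) ⊆ N`, the ball `K(B(0, R/√2))` is a ball piece relative to `N`
  (reparametrisation `x ↦ K(R x/√(1 + ‖x‖²))` by Mathlib's `univUnitBall`, which carries `ℝ⁴` onto
  `B(0, R)` and the unit ball onto `B(0, R/√2)`).

Both through `Literature.Geometry.Manifold.isSmoothEmbedding_comp_of_inverse`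
(`OpenEmbeddingCriterion.lean`).

## References

* B.-L. Chen, X.-P. Zhu, *Ricci flow with surgery on four-manifolds with positive isotropic
  curvature*, J. Differential Geom. 74 (2006), Thm. 1.1 (iii) (arXiv:math/0504478, p. 3) and §5,
  p. 29. [ChenZhu2006]
* R. S. Hamilton, *Four-manifolds with positive isotropic curvature*, Comm. Anal. Geom. 5 (1997),
  §D1 (p. 47: collars of the surgery). [Hamilton1997]
-/

open scoped Manifold ContDiff Topology
open Set Function Metric Topology

noncomputable section

namespace Literature.Geometry.Riemannian

open Literature.Geometry.Manifold

variable {M : Type} [TopologicalSpace M] [ChartedSpace (EuclideanSpace ℝ (Fin 4)) M]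
  [IsManifold (𝓡 4) ∞ M]

/-- The model of the cylinder `S³ × ℝ` has dimension `4`. [folklore] -/
theorem finrank_euclideanThree_prod_real :
    Module.finrank ℝ (EuclideanSpace ℝ (Fin 3) × ℝ) = Module.finrank ℝ (EuclideanSpace ℝ (Fin 4)) := by
  rw [Module.finrank_prod]; simp

/-! ### Neck pieces from tube segments -/

/-- **A segment of a tube is a neck piece.** If `ι : S³ × ℝ ↪ M⁴` is a smooth embedding with open
range, `t₁ < t₂`, and `ι(S³ × (ℝ ∖ (t₁, t₂))) ⊆ N`, then `ι(S³ × (t₁, t₂))` is a collared neck piece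
relative to `N` (`IsNeckPiece`), witnessed by `ι ∘ (θ, u) ↦ (θ, t₁ + (t₂ - t₁) u)`.
[cite: ChenZhu2006, Thm. 1.1 (iii) (p. 3) and §5, p. 29] -/
theorem isNeckPiece_image_Ioo
    {ι : (sphere (0 : EuclideanSpace ℝ (Fin 4)) 1) × ℝ → M}
    (hι : Manifold.IsSmoothEmbedding ((𝓡 3).prod 𝓘(ℝ, ℝ)) (𝓡 4) ∞ ι) (hιo : IsOpen (range ι))
    {t₁ t₂ : ℝ} (ht : t₁ < t₂) {N : Set M} (hN : ι '' (univ ×ˢ (Ioo t₁ t₂)ᶜ) ⊆ N) :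
    IsNeckPiece N (ι '' (univ ×ˢ Ioo t₁ t₂)) := by
  haveI : Fact (Module.finrank ℝ (EuclideanSpace ℝ (Fin 4)) = 3 + 1) := ⟨by simp⟩
  haveI : Nonempty (sphere (0 : EuclideanSpace ℝ (Fin 4)) 1) :=
    ⟨⟨EuclideanSpace.single 0 1, by simp⟩⟩
  have hd : 0 < t₂ - t₁ := sub_pos.2 ht
  -- the affine reparametrisation of the height and its inverse
  set a : ℝ → ℝ := fun u ↦ t₁ + (t₂ - t₁) * u with ha
  set b : ℝ → ℝ := fun s ↦ (s - t₁) / (t₂ - t₁) with hb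
  have hba : ∀ u, b (a u) = u := fun u ↦ by simp only [ha, hb]; field_simp; ring
  have hab : ∀ s, a (b s) = s := fun s ↦ by simp only [ha, hb]; field_simp; ring
  have hamem : ∀ u, a u ∈ Ioo t₁ t₂ ↔ u ∈ Ioo (0 : ℝ) 1 := by
    intro u
    simp only [ha, mem_Ioo]
    constructor
    · rintro ⟨h1, h2⟩; constructor <;> nlinarith
    · rintro ⟨h1, h2⟩; constructor <;> nlinarith
  set φ : (sphere (0 : EuclideanSpace ℝ (Fin 4)) 1) × ℝ → (sphere (0 : EuclideanSpace ℝ (Fin 4)) 1) × ℝ :=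
    fun q ↦ (q.1, a q.2) with hφ
  set φinv : (sphere (0 : EuclideanSpace ℝ (Fin 4)) 1) × ℝ → (sphere (0 : EuclideanSpace ℝ (Fin 4)) 1) × ℝ :=
    fun q ↦ (q.1, b q.2) with hφinv
  have hleft : ∀ q, φinv (φ q) = q := fun q ↦ Prod.ext rfl (hba q.2)
  have hright : ∀ q, φ (φinv q) = q := fun q ↦ Prod.ext rfl (hab q.2)
  have has : ContDiff ℝ ∞ a := contDiff_const.add (contDiff_const.mul contDiff_id)
  have hbs : ContDiff ℝ ∞ b := (contDiff_id.sub contDiff_const).div_const _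
  have hφs : ContMDiff ((𝓡 3).prod 𝓘(ℝ, ℝ)) ((𝓡 3).prod 𝓘(ℝ, ℝ)) ∞ φ :=
    contMDiff_fst.prodMk (has.comp_contMDiff contMDiff_snd)
  have hφinvs : ContMDiff ((𝓡 3).prod 𝓘(ℝ, ℝ)) ((𝓡 3).prod 𝓘(ℝ, ℝ)) ∞ φinv :=
    contMDiff_fst.prodMk (hbs.comp_contMDiff contMDiff_snd)
  let e : (sphere (0 : EuclideanSpace ℝ (Fin 4)) 1) × ℝ ≃ₜ (sphere (0 : EuclideanSpace ℝ (Fin 4)) 1) × ℝ :=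
    { toFun := φ, invFun := φinv, left_inv := hleft, right_inv := hright,
      continuous_toFun := hφs.continuous, continuous_invFun := hφinvs.continuous }
  have hφo : IsOpenMap φ := e.isOpenMap
  have hφinj : Injective φ := e.injective
  obtain ⟨hemb, hopen, hrange⟩ := isSmoothEmbedding_comp_of_inverse hι hιo hφs hφinj hφo
    hφinvs.contMDiffOn hleft (ContinuousLinearEquiv.ofFinrankEq finrank_euclideanThree_prod_real)
  -- the images
  have himage : ∀ S : Set ℝ, φ '' (univ ×ˢ S) = univ ×ˢ (a '' S) := by
    intro S
    ext ⟨θ, s⟩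
    simp only [mem_image, mem_prod, mem_univ, true_and, Prod.exists, hφ, Prod.mk.injEq]
    constructor
    · rintro ⟨θ', u, hu, rfl, rfl⟩; exact ⟨u, hu, rfl⟩
    · rintro ⟨u, hu, rfl⟩; exact ⟨θ, u, hu, rfl, rfl⟩
  have haIoo : a '' Ioo 0 1 = Ioo t₁ t₂ := by
    ext s
    constructor
    · rintro ⟨u, hu, rfl⟩; exact (hamem u).2 hu
    · intro hs; exact ⟨b s, (hamem _).1 (by rwa [hab]), hab s⟩
  have haIooc : a '' (Ioo 0 1)ᶜ = (Ioo t₁ t₂)ᶜ := by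
    ext s
    constructor
    · rintro ⟨u, hu, rfl⟩ h; exact hu ((hamem u).1 h)
    · intro hs
      refine ⟨b s, fun h ↦ hs ?_, hab s⟩
      have := (hamem (b s)).2 h
      rwa [hab] at this
  refine ⟨ι ∘ φ, hemb, hopen, ?_, ?_⟩
  · rw [image_comp, himage, haIoo]
  · rw [image_comp, himage, haIooc]; exact hN

/-! ### Ball pieces from ball embeddings -/

/-- The radial squeeze `x ↦ R x/√(1 + ‖x‖²)` of `ℝ⁴` onto `B(0, R)`: norm of the image.
[folklore] -/
theorem norm_smul_univUnitBall {F : Type*} [NormedAddCommGroup F] [NormedSpace ℝ F] {R : ℝ}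
    (hR : 0 < R) (x : F) :
    ‖R • (OpenPartialHomeomorph.univUnitBall x : F)‖ = R * ‖x‖ / Real.sqrt (1 + ‖x‖ ^ 2) := by
  have hpos : 0 < Real.sqrt (1 + ‖x‖ ^ 2) := Real.sqrt_pos.2 (by positivity)
  rw [OpenPartialHomeomorph.univUnitBall_apply, norm_smul, norm_smul, norm_inv, Real.norm_eq_abs,
    Real.norm_eq_abs, abs_of_pos hR, abs_of_pos hpos]
  field_simp

/-- `R ‖x‖/√(1 + ‖x‖²) < R`. [folklore] -/
theorem norm_smul_univUnitBall_lt {F : Type*} [NormedAddCommGroup F] [NormedSpace ℝ F] {R : ℝ}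
    (hR : 0 < R) (x : F) : ‖R • (OpenPartialHomeomorph.univUnitBall x : F)‖ < R := by
  rw [norm_smul_univUnitBall hR]
  have hpos : 0 < Real.sqrt (1 + ‖x‖ ^ 2) := Real.sqrt_pos.2 (by positivity)
  rw [div_lt_iff₀ hpos]
  have hlt : ‖x‖ < Real.sqrt (1 + ‖x‖ ^ 2) := by
    rw [Real.lt_sqrt (norm_nonneg x)]; linarith
  nlinarith

/-- `R ‖x‖/√(1 + ‖x‖²) < R/√2 ↔ ‖x‖ < 1`. [folklore] -/
theorem norm_smul_univUnitBall_lt_iff {F : Type*} [NormedAddCommGroup F] [NormedSpace ℝ F] {R : ℝ}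
    (hR : 0 < R) (x : F) :
    ‖R • (OpenPartialHomeomorph.univUnitBall x : F)‖ < R / Real.sqrt 2 ↔ ‖x‖ < 1 := by
  rw [norm_smul_univUnitBall hR]
  have hpos : 0 < Real.sqrt (1 + ‖x‖ ^ 2) := Real.sqrt_pos.2 (by positivity)
  have h2 : 0 < Real.sqrt 2 := by positivity
  have key : ‖x‖ * Real.sqrt 2 < Real.sqrt (1 + ‖x‖ ^ 2) ↔ ‖x‖ < 1 := by
    rw [Real.lt_sqrt (by positivity), mul_pow, Real.sq_sqrt (by norm_num : (0 : ℝ) ≤ 2)]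
    constructor
    · intro h; nlinarith [norm_nonneg x]
    · intro h; nlinarith [norm_nonneg x]
  rw [div_lt_div_iff₀ hpos h2, ← key]
  constructor
  · intro h
    exact lt_of_mul_lt_mul_left (show R * (‖x‖ * Real.sqrt 2) < R * Real.sqrt (1 + ‖x‖ ^ 2) by
      nlinarith) hR.le
  · intro h
    nlinarith [mul_lt_mul_of_pos_left h hR]

/-- **A ball of a ball embedding is a ball piece.** If `K : ℝ⁴ ↪ M⁴` is a smooth embedding with
open range, `R > 0`, and `K({R/√2 ≤ ‖y‖ < R}) ⊆ N`, then `K(B(0, R/√2))` is a collared ball piece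
relative to `N` (`IsBallPiece`), witnessed by `x ↦ K(R x/√(1 + ‖x‖²))`.
[cite: ChenZhu2006, Thm. 1.1 (iii) (p. 3) and §5, p. 29] -/
theorem isBallPiece_image_ball {K : EuclideanSpace ℝ (Fin 4) → M}
    (hK : Manifold.IsSmoothEmbedding (𝓡 4) (𝓡 4) ∞ K) (hKo : IsOpen (range K)) {R : ℝ} (hR : 0 < R)
    {N : Set M} (hN : K '' {y | R / Real.sqrt 2 ≤ ‖y‖ ∧ ‖y‖ < R} ⊆ N) :
    IsBallPiece N (K '' ball 0 (R / Real.sqrt 2)) := by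
  set U := (OpenPartialHomeomorph.univUnitBall : OpenPartialHomeomorph (EuclideanSpace ℝ (Fin 4))
    (EuclideanSpace ℝ (Fin 4))) with hU
  set φ : EuclideanSpace ℝ (Fin 4) → EuclideanSpace ℝ (Fin 4) := fun x ↦ R • U x with hφ
  set φinv : EuclideanSpace ℝ (Fin 4) → EuclideanSpace ℝ (Fin 4) := fun y ↦ U.symm (R⁻¹ • y) with hφinv
  have hRne : R ≠ 0 := hR.ne'
  have hUleft : ∀ x, U.symm (U x) = x := fun x ↦ U.left_inv (by simp [hU, OpenPartialHomeomorph.univUnitBall_source])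
  have hleft : ∀ x, φinv (φ x) = x := fun x ↦ by
    simp only [hφ, hφinv, smul_smul, inv_mul_cancel₀ hRne, one_smul, hUleft]
  have hφs : ContMDiff (𝓡 4) (𝓡 4) ∞ φ :=
    ((contDiff_const_smul R).comp OpenPartialHomeomorph.contDiff_univUnitBall).contMDiff
  have hφinj : Injective φ := fun x y h ↦ by rw [← hleft x, ← hleft y, h]
  have hUo : IsOpenMap U := (U.to_isOpenEmbedding (by simp [hU, OpenPartialHomeomorph.univUnitBall_source])).isOpenMap
  have hφo : IsOpenMap φ := (Homeomorph.smulOfNeZero R hRne).isOpenMap.comp hUo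
  -- the range of `φ` is the ball `B(0, R)`
  have hφlt : ∀ x, ‖φ x‖ < R := fun x ↦ norm_smul_univUnitBall_lt hR x
  have hφsurj : ∀ y : EuclideanSpace ℝ (Fin 4), ‖y‖ < R → φ (φinv y) = y := by
    intro y hy
    have hmem : R⁻¹ • y ∈ ball (0 : EuclideanSpace ℝ (Fin 4)) 1 := by
      rw [mem_ball_zero_iff, norm_smul, norm_inv, Real.norm_eq_abs, abs_of_pos hR,
        inv_mul_lt_iff₀ hR]
      simpa using hy
    have hmem' : R⁻¹ • y ∈ U.target := by
      simpa [hU, OpenPartialHomeomorph.univUnitBall_target] using hmem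
    simp only [hφ, hφinv]
    rw [U.right_inv hmem', smul_smul, mul_inv_cancel₀ hRne, one_smul]
  have hrangeφ : range φ = ball 0 R := by
    apply Subset.antisymm
    · rintro _ ⟨x, rfl⟩; exact mem_ball_zero_iff.2 (hφlt x)
    · intro y hy; exact ⟨φinv y, hφsurj y (mem_ball_zero_iff.1 hy)⟩
  have hφinvs : ContMDiffOn (𝓡 4) (𝓡 4) ∞ φinv (range φ) := by
    rw [hrangeφ, contMDiffOn_iff_contDiffOn]
    have h1 : ContDiffOn ℝ ∞ U.symm (ball 0 1) := OpenPartialHomeomorph.contDiffOn_univUnitBall_symm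
    refine h1.comp (contDiff_const_smul R⁻¹).contDiffOn fun y hy ↦ ?_
    rw [mem_ball_zero_iff] at hy ⊢
    rw [norm_smul, norm_inv, Real.norm_eq_abs, abs_of_pos hR, inv_mul_lt_iff₀ hR]
    simpa using hy
  obtain ⟨hemb, hopen, hrange⟩ := isSmoothEmbedding_comp_of_inverse hK hKo hφs hφinj hφo hφinvs
    hleft (ContinuousLinearEquiv.refl ℝ _)
  -- the images
  have hball : φ '' ball 0 1 = ball 0 (R / Real.sqrt 2) := by
    apply Subset.antisymm
    · rintro _ ⟨x, hx, rfl⟩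
      exact mem_ball_zero_iff.2 ((norm_smul_univUnitBall_lt_iff hR x).2 (mem_ball_zero_iff.1 hx))
    · intro y hy
      have hyR : ‖y‖ < R := by
        have h2 : 1 ≤ Real.sqrt 2 := Real.one_le_sqrt.2 (by norm_num)
        exact lt_of_lt_of_le (mem_ball_zero_iff.1 hy) (div_le_self hR.le h2)
      refine ⟨φinv y, ?_, hφsurj y hyR⟩
      rw [mem_ball_zero_iff, ← norm_smul_univUnitBall_lt_iff hR]
      show ‖φ (φinv y)‖ < R / Real.sqrt 2
      rw [hφsurj y hyR]; exact mem_ball_zero_iff.1 hy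
  have hcompl : φ '' (ball 0 1)ᶜ = {y | R / Real.sqrt 2 ≤ ‖y‖ ∧ ‖y‖ < R} := by
    apply Subset.antisymm
    · rintro _ ⟨x, hx, rfl⟩
      refine ⟨?_, hφlt x⟩
      rw [mem_compl_iff, mem_ball_zero_iff, not_lt] at hx
      exact not_lt.1 fun h ↦ (not_lt.2 hx) ((norm_smul_univUnitBall_lt_iff hR x).1 h)
    · rintro y ⟨hy1, hy2⟩
      refine ⟨φinv y, ?_, hφsurj y hy2⟩
      rw [mem_compl_iff, mem_ball_zero_iff, ← norm_smul_univUnitBall_lt_iff hR]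
      show ¬ ‖φ (φinv y)‖ < R / Real.sqrt 2
      rw [hφsurj y hy2]; exact not_lt.2 hy1
  refine ⟨K ∘ φ, hemb, hopen, ?_, ?_⟩
  · rw [image_comp, hball]
  · rw [image_comp, hcompl]; exact hN

end Literature.Geometry.Riemannian

end
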